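import Mathlib
import Summits.Ventures.PercRepro2.TypedDomainInstanceSep2
import Summits.Ventures.PercRepro2.TypedBundleEight

/-!
# The domain of record at `|F| ≥ 8` is not empty (blind cell PercRepro2, p2 g6 / g7, 2026-08-25/26):
the separator-free 14-edge instance of TypedDomainInstanceSep2.lean (all sixteen conditions) has
fourteen typed edges.  Own code; standard axioms.
-/

namespace Summit.Ventures.PercRepro2

namespace CovForm

namespace TypedRed

namespace NonVacuity14

/-- **The domain of record at `|F| ≥ 8` is not empty.** -/
theorem instance16_mem8 : ResidualCoreNHatCTBRASUDO7SP2E ends14 0 1 2 3 4 F14 :=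
  ⟨instance16_mem, by decide⟩

end NonVacuity14

end TypedRed

end CovForm

end Summit.Ventures.PercRepro2
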